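import Mathlib
import Literature.NumberTheory.LFunctions.Zhang2022.SkeletonPartTwo
import Literature.NumberTheory.LFunctions.Zhang2022.SkeletonAssembly
import Literature.NumberTheory.LFunctions.Zhang2022.SkeletonReductions
import Literature.NumberTheory.LFunctions.Zhang2022.TypedSection11B
import Literature.NumberTheory.LFunctions.Zhang2022.AppendixALemma83Local
import HarnessLib

/-!
# Zhang (2022) §11: the deduction nodes `DedStep11u020`, `DedStep11u025/026`, `DedLem112`, and
# the total mass `ΣΣ𝔠*ω` from Lemma 8.1 + Proposition 7.1

Topic `Literature/NumberTheory/LFunctions/Zhang2022` (Landau–Siegel audit tree; verdict-neutral).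
Y. Zhang, *Discrete mean estimates and the Landau–Siegel zero*, arXiv:2211.02515v1 (2022)
[Zhang2022LandauSiegel], §11 "Proof of Proposition 2.6", PDF pp. 62–66, tex L3189–L3352 — **an
unrefereed manuscript under adjudication; nothing here asserts or denies its Theorems 1–2.**

Cell `siegel-zhang`, DAG nodes `Z22:Prop2.6.pf` (part) and `Z22:Lem11.2.pf` (discharge seat d36).
The statement file `TypedSection11B` (L3-t10) types the one-word deductions of §11 pp. 64–65 as
named implications between the printed displays; it proves `DedEq116`, `DedProp26` itself. This
file proves the remaining ones:

* `dedStep11u020_holds : DedStep11u020 c′` — "Hence `ΣΣ𝔠*|J₁ − J̃₁|²ω = o(𝔞𝔓)`" (p. 64) from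
  (11.5) (`Eq115`) and the windowed mean square (`Step11u019`), the `O(ε)²` term being absorbed by
  the **total mass** `ΣΣ𝔠*(ρ,ψ)ω(ρ) ≪ 𝓛⁹𝔓` (`totalMass_le`), which is what Lemma 8.1 and
  Proposition 7.1 give at the admissible pair `𝐚₁ = 𝐚₂ = δ₁` (`A(δ₁;s,ψ) = 1`, `S_j(δ₁,δ₁) = 1`,
  `|Θ₁(δ₁,δ₁)| ≤ 4𝔓/α + O(𝓛²𝔓)` — `Sj_delta1`, `norm_Theta1_delta1_le`);
* `dedStep11u025_holds`, `dedStep11u026_holds`, `dedLem112_holds` — Lemma 11.2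
  (`Skeleton.Lemma112`) from the smooth approximate functional equation `Step11u024` ("in a way
  similar to the proof of Lemma 6.1", the analytic leaf): the series `J̃₁(s,ψ) = Σ_nχψ(n)g̃₁(n)n^{−s}`
  and `J̃₂(1−s,ψ̄)` are integrated in `z` term by term (dominated convergence on `σ = 1/2` with
  `0 ≤ g(y) ≤ 2y`, so `|χψ(n)n^{−s}g(P^z/n)| ≤ 2P^{0.504}n^{−3/2}`), `∫_{0.5}^{0.502}G(1−z)dz =
  ∫_{0.498}^{0.5}G`, and the two `(1/500)L(s,χψ)` cancel between the windows of `g̃₁`.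

Silent inputs made explicit (as in `Skeleton.prop26_of_evals`): Lemma 2.3 (`𝔠* ≥ 0` real on
`Ψ₁ × 𝔷(ψ)`), Prop. 2.2 (i) (zeros on `σ = 1/2`: `ω(ρ) > 0` real, and (11.5), stated for `σ = 1/2`,
applies at `s = ρ`). 0 new facts; standard axioms.

## References

* Y. Zhang, arXiv:2211.02515v1 (2022), §11 pp. 62–66; §7 Prop. 7.1, (7.2); §8 Lemma 8.1.
  [cite: Zhang2022LandauSiegel, §11]
-/

noncomputable section

open Complex Real ComplexConjugate

/-! ## The deductions, proved -/

namespace Literature.NumberTheory.LFunctions.Zhang2022.Section11Deductions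

open Literature.NumberTheory.LFunctions.Zhang2022.Skeleton
open Literature.NumberTheory.LFunctions.Zhang2022.Typed.TypedSection11B

section Pointwise

variable {D : ℕ} [NeZero D] (χ : DirichletCharacter ℂ D)

omit [NeZero D] in
/-- An index of the double sum `ΣΣ` of (2.16) is a pair `(ψ, ρ)` with `ψ ∈ Ψ₁`, `ρ ∈ 𝔷(ψ)`.
[cite: Zhang2022LandauSiegel, §2 (2.16)] -/
theorem mem_idx {i : (_ : Chr D) × ℂ} (hi : i ∈ idx χ) : i.1 ∈ PsiOne χ ∧ i.2 ∈ zeroSet D i.1 := by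
  rw [idx, Finset.mem_sigma] at hi
  exact ⟨mem_of_mem_finsetOf hi.1, mem_of_mem_finsetOf hi.2⟩

end Pointwise

/-! ### The total mass `ΣΣ𝔠*(ρ,ψ)ω(ρ)` from Lemma 8.1 and Proposition 7.1

The node `DedStep11u020` cites Lemma 8.1 and Proposition 7.1 "to absorb the `O(ε)²` term" of
(11.5): what is needed from them is an upper bound for the total mass `ΣΣ𝔠*ω` of the weights, which
they give at the admissible pair `𝐚₁ = 𝐚₂ = δ₁ = (1,0,0,…)` (then `A(𝐚;s,ψ) = 1`, `S_j(δ₁,δ₁) = 1`,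
so `ΣΣ𝔠*ω = 2Re Θ₁(δ₁,δ₁) + o(𝔓)` and `|Θ₁(δ₁,δ₁)| ≤ 4𝔓/α + O(𝔓𝓛²) ≪ 𝓛⁹𝔓`). -/

section Mass

/-- The test sequence `δ₁ = (1, 0, 0, …) = Pi.single 1 1` is real: `conj ∘ δ₁ = δ₁`.
[cite: Zhang2022LandauSiegel, §7 (7.2)] -/
theorem conj_single_one : (fun n : ℕ => conj ((Pi.single 1 1 : ℕ → ℂ) n)) = Pi.single 1 1 := by
  funext n
  by_cases h : n = 1
  · rw [h, Pi.single_eq_same, map_one]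
  · rw [Pi.single_eq_of_ne h, map_zero]

/-- `log D ≥ 2` once `D ≥ 8`. [folklore] -/
private theorem two_le_log_of_eight_le {D : ℕ} (hD : 8 ≤ D) : 2 ≤ Real.log D := by
  have h8 : (8 : ℝ) ≤ D := by exact_mod_cast hD
  have h2 : (2 : ℝ) ≤ Real.log 8 := by
    rw [Real.le_log_iff_exp_le (by norm_num)]
    have h1 := Real.exp_one_lt_d9
    have h0 := Real.exp_pos 1
    have hsq : Real.exp 2 = Real.exp 1 * Real.exp 1 := by rw [← Real.exp_add]; norm_num
    rw [hsq]
    nlinarith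
  exact h2.trans (Real.log_le_log (by norm_num) h8)

variable (c' : ℝ) {D : ℕ}

/-- For `log D ≥ 2`: `1 < PT⁻²` (indeed `P₁ < PT⁻²`, `SkeletonReductions`). [cite: Zhang2022LandauSiegel, §7 (7.2)] -/
theorem one_lt_P_div_T_sq (hD : 2 ≤ Real.log D) : 1 < bigP D / bigT D ^ 2 := by
  have hP : 1 ≤ bigP D := Real.one_le_exp (by rw [ell]; positivity)
  have h1 : 1 ≤ Skeleton.P1 D := by
    rw [Skeleton.P1]; exact Real.one_le_rpow hP (by norm_num)
  exact lt_of_le_of_lt h1 (P1_lt_P_div_T_sq D hD)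

/-- For `log D ≥ 2`: `⌈PT⁻²⌉ ≥ 2`. [cite: Zhang2022LandauSiegel, §7 (7.2)] -/
theorem two_le_Nsupp (hD : 2 ≤ Real.log D) : 2 ≤ Nsupp D := by
  rw [Nsupp]
  have h := one_lt_P_div_T_sq hD
  exact Nat.lt_ceil.mpr (by exact_mod_cast h)

/-- `δ₁` satisfies (7.2) with `B = 1` (for `log D ≥ 2`). [cite: Zhang2022LandauSiegel, §7 (7.2)] -/
theorem adm72_delta1 (hD : 2 ≤ Real.log D) : Adm72 D 1 (Pi.single 1 1 : ℕ → ℂ) := by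
  refine ⟨fun n => ?_, fun n hn => ?_⟩
  · by_cases h : n = 1
    · subst h; simp
    · simp [h]
  · have h1 : n ≠ 1 := by
      rintro rfl
      have := one_lt_P_div_T_sq hD
      push_cast at hn
      linarith
    simp [h1]

/-- `A(δ₁;s,ψ) = 1`. [cite: Zhang2022LandauSiegel, §7 p. 13] -/
theorem Apoly_delta1 (x : Chr D) (hD : 2 ≤ Real.log D) (s : ℂ) : Apoly x (Pi.single 1 1) s = 1 := by
  rw [Apoly, Lemma81.dirPoly_def, Finset.sum_eq_single 1]
  · simp
  · intro n _ hn
    simp [hn]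
  · intro h
    exact absurd (Finset.mem_range.mpr (lt_of_lt_of_le one_lt_two (two_le_Nsupp hD))) h

/-- `A(δ₁;1−s,ψ̄) = 1`. [cite: Zhang2022LandauSiegel, §7 p. 13] -/
theorem ApolyBar_delta1 (x : Chr D) (hD : 2 ≤ Real.log D) (s : ℂ) :
    ApolyBar x (Pi.single 1 1) s = 1 := by
  rw [ApolyBar, Lemma81.dirPoly_def, Finset.sum_eq_single 1]
  · simp
  · intro n _ hn
    simp [hn]
  · intro h
    exact absurd (Finset.mem_range.mpr (lt_of_lt_of_le one_lt_two (two_le_Nsupp hD))) h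

/-- At `(δ₁,δ₁)` the left side of Lemma 8.1 is the total mass `ΣΣ𝔠*(ρ,ψ)ω(ρ)`.
[cite: Zhang2022LandauSiegel, §8 Lemma 8.1] -/
theorem lhs81_delta1 [NeZero D] (χ : DirichletCharacter ℂ D) (hD : 2 ≤ Real.log D) :
    lhs81 c' χ (Pi.single 1 1) (Pi.single 1 1) = ∑ i ∈ idx χ, cstar c' D i.1 i.2 * omegaW D i.2 := by
  rw [lhs81]
  refine Finset.sum_congr rfl fun i _ => ?_
  rw [Apoly_delta1 _ hD, ApolyBar_delta1 _ hD]; ring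

/-- `λ₀ⱼ(1) = 1` (empty product). [cite: Zhang2022LandauSiegel, §7 p. 13] -/
theorem lamZero_one (j : ℕ) : lamZero c' D j 1 = 1 := by
  rw [lamZero, lam, Nat.primeFactors_one, Finset.prod_empty]

/-- `λ̃₀ⱼ(1,dr) = 1` (empty product). [cite: Zhang2022LandauSiegel, §7 p. 13] -/
theorem lamTildeZero_one (j dr : ℕ) : lamTildeZero c' D j 1 dr = 1 := by
  rw [lamTildeZero, Nat.primeFactors_one, Finset.filter_empty, Finset.prod_empty]

/-- `κ̃(1;1,s) = κ(1) = 1`. [cite: Zhang2022LandauSiegel, §7 p. 13] -/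
theorem kappaTilde_one_one (s : ℂ) : kappaTilde c' D 1 1 s = 1 := by
  rw [kappaTilde, tsum_eq_single 1]
  · rw [if_pos ⟨Lemma83.mem_nset_one_iff.mpr rfl, Nat.coprime_one_right 1⟩, mul_one, Nat.cast_one,
      Complex.one_cpow, div_one, kappaZ, (MeanSquareMajorant.isMultiplicative_kappa _ _ _).map_one]
  · intro h hh
    rw [if_neg]
    rintro ⟨hn, -⟩
    exact hh (Lemma83.mem_nset_one_iff.mp hn)

/-- `ξ₀ⱼ(1;1,1) = 1`. [cite: Zhang2022LandauSiegel, §7 p. 13] -/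
theorem xiZero_one (j : ℕ) : xiZero c' D j 1 1 1 = 1 := by
  rw [xiZero, lamTildeZero_one, Nat.divisors_one, Finset.filter_singleton,
    if_pos (Nat.coprime_one_right 1), Finset.sum_singleton, Nat.div_one, kappaTildeZero, mul_one,
    mul_one, kappaTilde_one_one, ArithmeticFunction.moebius_apply_one, Nat.totient_one]
  simp

/-- **`S_j(δ₁,δ₁) = 1`**: only `d = r = m = n = 1` contributes. [cite: Zhang2022LandauSiegel, §7 Prop. 7.1] -/
theorem Sj_delta1 (hD : 2 ≤ Real.log D) (j : ℕ) : Sj c' D j (Pi.single 1 1) (Pi.single 1 1) = 1 := by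
  have hN := two_le_Nsupp hD
  have h1 : 1 ∈ Finset.Ico 1 (Nsupp D) := Finset.mem_Ico.mpr ⟨le_rfl, by omega⟩
  have inner : ∀ d r : ℕ, d * r ≠ 1 →
      ∑ m ∈ Finset.Ico 1 (Nsupp D),
        (Pi.single 1 1 : ℕ → ℂ) (d * r * m) / (m : ℂ) ^ (1 - betaJ c' D j) = 0 := by
    intro d r hdr
    refine Finset.sum_eq_zero fun m _ => ?_
    have : d * r * m ≠ 1 := fun h => hdr (Nat.eq_one_of_mul_eq_one_right h)
    simp [this]
  rw [Sj, Finset.sum_eq_single_of_mem 1 h1, Finset.sum_eq_single_of_mem 1 h1]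
  · -- the term `d = r = 1`
    have hm : ∑ m ∈ Finset.Ico 1 (Nsupp D),
        (Pi.single 1 1 : ℕ → ℂ) (1 * 1 * m) / (m : ℂ) ^ (1 - betaJ c' D j) = 1 := by
      rw [Finset.sum_eq_single_of_mem 1 h1]
      · simp
      · intro m _ hm
        simp [hm]
    have hn : ∑ n ∈ Finset.Ico 1 (Nsupp D),
        (Pi.single 1 1 : ℕ → ℂ) (1 * 1 * n) * xiZero c' D j n 1 1 / (n : ℂ) = 1 := by
      rw [Finset.sum_eq_single_of_mem 1 h1]
      · simp [xiZero_one]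
      · intro n _ hn'
        simp [hn']
    rw [hm, hn, mul_one, lamZero_one, ArithmeticFunction.moebius_apply_one, Nat.totient_one]
    norm_num
  · intro r _ hr
    have : 1 * r ≠ 1 := by simpa using hr
    rw [inner 1 r this]; ring
  · intro d _ hd
    refine Finset.sum_eq_zero fun r _ => ?_
    have : d * r ≠ 1 := fun h => hd (Nat.eq_one_of_mul_eq_one_right h)
    rw [inner d r this]; ring

/-- `E(δ₁,δ₁) = 3𝓛²𝔓`. [cite: Zhang2022LandauSiegel, §7 Prop. 7.1] -/
theorem Ecal_delta1 (hD : 2 ≤ Real.log D) :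
    Ecal c' D (Pi.single 1 1) (Pi.single 1 1) = 3 * ell D ^ 2 * frakP D := by
  rw [Ecal, Sj_delta1 c' hD, Sj_delta1 c' hD, Sj_delta1 c' hD, norm_one]; ring

/-- The main term of Prop. 7.1 at `(δ₁,δ₁)` is `4𝔓/α = (4/π)𝓛⁹𝔓` in absolute value.
[cite: Zhang2022LandauSiegel, §7 Prop. 7.1] -/
theorem norm_mainMV_delta1 (hD : 2 ≤ Real.log D) :
    ‖mainMV c' D (Pi.single 1 1) (Pi.single 1 1)‖ = 4 / π * ell D ^ 9 * frakP D := by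
  have hα : alpha D = π / ell D ^ 9 := by rw [alpha, bigP, Real.log_exp]
  have hℓ : 0 < ell D := by rw [ell]; linarith
  have hval : mainMV c' D (Pi.single 1 1) (Pi.single 1 1) = ((4 / π * ell D ^ 9 * frakP D : ℝ) : ℂ) := by
    rw [mainMV, Sj_delta1 c' hD, Sj_delta1 c' hD, Sj_delta1 c' hD, hα]
    have hπ : (π : ℂ) ≠ 0 := by exact_mod_cast Real.pi_ne_zero
    have hℓ' : ((ell D : ℝ) : ℂ) ≠ 0 := by exact_mod_cast hℓ.ne'
    push_cast
    field_simp
    ring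
  rw [hval, Complex.norm_real, Real.norm_of_nonneg]
  have := frakP_nonneg D
  positivity

/-- **`|Θ₁(δ₁,δ₁)| ≪ 𝓛⁹𝔓`** from Proposition 7.1 (main term `4𝔓/α`, `E(δ₁,δ₁) = 3𝓛²𝔓`).
[cite: Zhang2022LandauSiegel, §7 Prop. 7.1] -/
theorem norm_Theta1_delta1_le (h71 : Prop71 c') :
    ∃ K : ℝ, 0 < K ∧ ForAllLarge fun D _ χ => AssumptionA D χ →
      ‖Theta1 c' χ (Pi.single 1 1) (Pi.single 1 1)‖ ≤ K * ell D ^ 9 * frakP D := by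
  obtain ⟨C, D₀, h⟩ := h71 1 1 one_pos
  refine ⟨4 / π + 3 * |C| + 1, by positivity, max D₀ 8, fun D _ χ hD hq hp hA => ?_⟩
  have hD8 : 8 ≤ D := le_trans (le_max_right _ _) hD
  have hlog := two_le_log_of_eight_le hD8
  have hℓ : 2 ≤ ell D := by rw [ell]; exact hlog
  have key := h D χ (le_trans (le_max_left _ _) hD) hq hp hA (Pi.single 1 1) (Pi.single 1 1)
    (adm72_delta1 hlog) (adm72_delta1 hlog)
  rw [Ecal_delta1 c' hlog] at key
  have hP : 0 ≤ frakP D := frakP_nonneg D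
  have hmain := norm_mainMV_delta1 c' hlog (D := D)
  have h9 : 1 ≤ ell D ^ 9 := one_le_pow₀ (by linarith)
  have h29 : ell D ^ 2 ≤ ell D ^ 9 := pow_le_pow_right₀ (by linarith) (by norm_num)
  have hC : C * (3 * ell D ^ 2 * frakP D) ≤ |C| * (3 * ell D ^ 9 * frakP D) :=
    mul_le_mul (le_abs_self C) (by gcongr) (by positivity) (abs_nonneg C)
  calc ‖Theta1 c' χ (Pi.single 1 1) (Pi.single 1 1)‖
      ≤ ‖mainMV c' D (Pi.single 1 1) (Pi.single 1 1)‖ + ‖Theta1 c' χ (Pi.single 1 1) (Pi.single 1 1) - mainMV c' D (Pi.single 1 1) (Pi.single 1 1)‖ :=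
        norm_le_insert' _ _
    _ ≤ 4 / π * ell D ^ 9 * frakP D + (C * (3 * ell D ^ 2 * frakP D) + 1 * frakP D) := by
        rw [hmain]; exact add_le_add le_rfl key
    _ ≤ (4 / π + 3 * |C| + 1) * ell D ^ 9 * frakP D := by
        nlinarith [mul_le_mul_of_nonneg_right h9 hP]

/-- **The total mass `ΣΣ𝔠*(ρ,ψ)ω(ρ) ≪ 𝓛⁹𝔓`** (real weights, Lemma 2.3 and Prop. 2.2 (i)), from
Lemma 8.1 and Prop. 7.1 at `(δ₁,δ₁)`. [cite: Zhang2022LandauSiegel, §8 Lemma 8.1; §7 Prop. 7.1] -/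
theorem totalMass_le (h23 : Lemma23 c') (h22 : Prop22i) (h81 : Lemma81 c') (h71 : Prop71 c') :
    ∃ K : ℝ, 0 < K ∧ ForAllLarge fun D _ χ => AssumptionA D χ →
      ∑ i ∈ idx χ, (cstar c' D i.1 i.2).re * (omegaW D i.2).re ≤ K * ell D ^ 9 * frakP D := by
  obtain ⟨K₁, hK₁, hΘ⟩ := norm_Theta1_delta1_le c' h71
  obtain ⟨D₀, h⟩ := ((h22.and h23).and hΘ).and (h81 1 1 one_pos)
  refine ⟨2 * K₁ + 1, by positivity, max D₀ 8, fun D _ χ hD hq hp hA => ?_⟩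
  have hD8 : 8 ≤ D := le_trans (le_max_right _ _) hD
  have hD3 : 3 ≤ D := le_trans (by norm_num) hD8
  have hlog := two_le_log_of_eight_le hD8
  have hℓ : 2 ≤ ell D := by rw [ell]; exact hlog
  obtain ⟨⟨⟨h22', h23'⟩, hΘ'⟩, h81'⟩ := h D χ (le_trans (le_max_left _ _) hD) hq hp
  have mem : ∀ i ∈ idx χ, i.1 ∈ PsiOne χ ∧ i.2 ∈ zeroSet D i.1 := fun i hi => mem_idx χ hi
  have hre : ∀ i ∈ idx χ, i.2.re = 1 / 2 := fun i hi =>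
    h22' i.1 (mem i hi).1 i.2 (mem_prodZeroSetOmega_of_mem_zeroSet χ (mem i hi).2)
  have hcIm : ∀ i ∈ idx χ, (cstar c' D i.1 i.2).im = 0 := fun i hi =>
    (h23' i.1 (mem i hi).1 i.2 (mem i hi).2).1
  have hωIm : ∀ i ∈ idx χ, (omegaW D i.2).im = 0 := fun i hi => (omegaW_re_pos hD3 (hre i hi)).2
  have k := h81' hA (Pi.single 1 1) (Pi.single 1 1) (adm72_delta1 hlog) (adm72_delta1 hlog)
  rw [conj_single_one, lhs81_delta1 c' χ hlog] at k
  have hΘ'' := hΘ' hA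
  have hP : 0 ≤ frakP D := frakP_nonneg D
  have h9 : 1 ≤ ell D ^ 9 := one_le_pow₀ (by linarith)
  have hre_sum : (∑ i ∈ idx χ, cstar c' D i.1 i.2 * omegaW D i.2).re =
      ∑ i ∈ idx χ, (cstar c' D i.1 i.2).re * (omegaW D i.2).re := by
    rw [Complex.re_sum]
    exact Finset.sum_congr rfl fun i hi => by rw [Complex.mul_re, hcIm i hi, hωIm i hi]; ring
  calc ∑ i ∈ idx χ, (cstar c' D i.1 i.2).re * (omegaW D i.2).re
      = (∑ i ∈ idx χ, cstar c' D i.1 i.2 * omegaW D i.2).re := hre_sum.symm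
    _ ≤ ‖∑ i ∈ idx χ, cstar c' D i.1 i.2 * omegaW D i.2‖ := Complex.re_le_norm _
    _ ≤ ‖Theta1 c' χ (Pi.single 1 1) (Pi.single 1 1) + conj (Theta1 c' χ (Pi.single 1 1) (Pi.single 1 1))‖ +
          ‖(∑ i ∈ idx χ, cstar c' D i.1 i.2 * omegaW D i.2) -
            (Theta1 c' χ (Pi.single 1 1) (Pi.single 1 1) + conj (Theta1 c' χ (Pi.single 1 1) (Pi.single 1 1)))‖ := norm_le_insert' _ _
    _ ≤ (‖Theta1 c' χ (Pi.single 1 1) (Pi.single 1 1)‖ + ‖Theta1 c' χ (Pi.single 1 1) (Pi.single 1 1)‖) + 1 * frakP D := by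
        refine add_le_add (le_trans (norm_add_le _ _) ?_) k
        rw [RCLike.norm_conj]
    _ ≤ (K₁ * ell D ^ 9 * frakP D + K₁ * ell D ^ 9 * frakP D) + 1 * frakP D := by gcongr
    _ ≤ (2 * K₁ + 1) * ell D ^ 9 * frakP D := by nlinarith [mul_le_mul_of_nonneg_right h9 hP]

end Mass

/-! ### `Z22:Prop2.6.pf` (part): the mean square of `J₁ − J̃₁` from (11.5) -/

/-- `e^{−y} ≤ 1/y` for `y > 0`. [folklore] -/
private theorem exp_neg_le_inv {y : ℝ} (hy : 0 < y) : Real.exp (-y) ≤ y⁻¹ := by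
  rw [Real.exp_neg]
  exact inv_anti₀ hy (by linarith [Real.add_one_le_exp y])

/-- **"Hence `ΣΣ𝔠*|J₁ − J̃₁|²ω = o(𝔞𝔓)`"** (p. 64; the content of `DedStep11u020`): at each index, `ρ` lies
on the critical line (Prop. 2.2 (i), so that (11.5), stated for `σ = 1/2`, applies at `s = ρ` and
`ω(ρ) > 0`), so by (11.5)
`|J₁ − J̃₁|² ≤ 2|Σ_{n∈𝔍₁}…|² + 2C²e^{−2c𝓛¹⁰}`; the first term has mean square `o(𝔞𝔓)` by
`Step11u019`, the second is absorbed by the total mass `ΣΣ𝔠*ω ≪ 𝓛⁹𝔓` (Lemma 8.1 + Prop. 7.1 at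
`(δ₁,δ₁)`, `totalMass_le`) and `𝔞 ≫ 1`, since `𝓛⁹e^{−c𝓛¹⁰} → 0`.
[cite: Zhang2022LandauSiegel, §11 p. 64, tex L3302–L3305] -/
theorem step11u020_of (c' : ℝ) (h23 : Lemma23 c') (h22 : Prop22i) (h81 : Lemma81 c')
    (h71 : Prop71 c') (ha : FrakALowerBound) (h115 : Eq115) (h19 : Step11u019 c') :
    Step11u020 c' := by
  intro ε hε
  obtain ⟨K, hK, hW⟩ := totalMass_le c' h23 h22 h81 h71
  obtain ⟨c, hc, C₁, h115⟩ := h115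
  obtain ⟨a₀, ha₀, ha⟩ := ha
  have hε4 : 0 < ε / 4 := by positivity
  obtain ⟨D₀, h⟩ := ((((h22.and h23).and hW).and h115).and (h19 _ hε4)).and ha
  -- the threshold beyond which `2C₁²K𝓛⁹e^{−c𝓛¹⁰} ≤ (ε/2)a₀`
  set δ : ℝ := ε * a₀ / (4 * (C₁ ^ 2 * K + 1)) with hδ
  have hδ0 : 0 < δ := by positivity
  set D₁ : ℕ := ⌈Real.exp (1 / (c * δ))⌉₊ with hD₁
  refine ⟨max (max D₀ D₁) 8, fun D _ χ hD hq hp hA => ?_⟩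
  have hD8 : 8 ≤ D := le_trans (le_max_right _ _) hD
  have hD3 : 3 ≤ D := le_trans (by norm_num) hD8
  have hlog := two_le_log_of_eight_le hD8
  have hℓ : 2 ≤ ell D := by rw [ell]; exact hlog
  have hDD₁ : D₁ ≤ D := le_trans (le_trans (le_max_right _ _) (le_max_left _ _)) hD
  obtain ⟨⟨⟨⟨⟨h22', h23'⟩, hW'⟩, h115'⟩, h19'⟩, ha'⟩ :=
    h D χ (le_trans (le_trans (le_max_left _ _) (le_max_left _ _)) hD) hq hp
  have mem : ∀ i ∈ idx χ, i.1 ∈ PsiOne χ ∧ i.2 ∈ zeroSet D i.1 := fun i hi => mem_idx χ hi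
  have hre : ∀ i ∈ idx χ, i.2.re = 1 / 2 := fun i hi =>
    h22' i.1 (mem i hi).1 i.2 (mem_prodZeroSetOmega_of_mem_zeroSet χ (mem i hi).2)
  have hc0 : ∀ i ∈ idx χ, 0 ≤ (cstar c' D i.1 i.2).re := fun i hi =>
    (h23' i.1 (mem i hi).1 i.2 (mem i hi).2).2
  have hω : ∀ i ∈ idx χ, 0 < (omegaW D i.2).re := fun i hi => (omegaW_re_pos hD3 (hre i hi)).1
  -- the size of `𝓛⁹e^{−c𝓛¹⁰}`
  have hℓpos : 0 < ell D := by linarith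
  have hsmall : ell D ^ 9 * Real.exp (-c * ell D ^ 10) ≤ δ := by
    have h1 : Real.exp (-c * ell D ^ 10) ≤ (c * ell D ^ 10)⁻¹ := by
      rw [neg_mul]; exact exp_neg_le_inv (by positivity)
    have h2 : ell D ^ 9 * (c * ell D ^ 10)⁻¹ = (c * ell D)⁻¹ := by
      field_simp
    have h3 : 1 / (c * δ) ≤ ell D := by
      have hexp : Real.exp (1 / (c * δ)) ≤ D :=
        le_trans (Nat.le_ceil _) (by exact_mod_cast hDD₁)
      have := Real.log_le_log (Real.exp_pos _) hexp
      rwa [Real.log_exp, ← ell] at this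
    have h4 : (c * ell D)⁻¹ ≤ δ := by
      rw [inv_le_comm₀ (by positivity) hδ0]
      calc δ⁻¹ = c * (1 / (c * δ)) := by field_simp
        _ ≤ c * ell D := mul_le_mul_of_nonneg_left h3 hc.le
    calc ell D ^ 9 * Real.exp (-c * ell D ^ 10) ≤ ell D ^ 9 * (c * ell D ^ 10)⁻¹ :=
          mul_le_mul_of_nonneg_left h1 (by positivity)
      _ = (c * ell D)⁻¹ := h2
      _ ≤ δ := h4
  -- termwise
  set E : ℝ := C₁ * Real.exp (-c * ell D ^ 10) with hE
  have hexp1 : Real.exp (-c * ell D ^ 10) ≤ 1 := by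
    rw [Real.exp_le_one_iff]; rw [neg_mul]; exact neg_nonpos.mpr (by positivity)
  have hE2 : E ^ 2 ≤ C₁ ^ 2 * Real.exp (-c * ell D ^ 10) := by
    rw [hE, mul_pow, sq (Real.exp _)]
    exact mul_le_mul_of_nonneg_left
      (mul_le_of_le_one_right (Real.exp_pos _).le hexp1) (sq_nonneg C₁)
  have hterm : ∀ i ∈ idx χ,
      (cstar c' D i.1 i.2).re * ‖J1 χ i.1 i.2 - Jtilde1 χ i.1 i.2‖ ^ 2 * (omegaW D i.2).re ≤
        2 * ((cstar c' D i.1 i.2).re * ‖frakI1Sum χ i.1 i.2‖ ^ 2 * (omegaW D i.2).re) +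
          2 * E ^ 2 * ((cstar c' D i.1 i.2).re * (omegaW D i.2).re) := by
    intro i hi
    have h1 : ‖J1 χ i.1 i.2 - Jtilde1 χ i.1 i.2‖ ≤ ‖frakI1Sum χ i.1 i.2‖ + E :=
      le_trans (norm_le_insert' _ _) (add_le_add le_rfl (h115' hA i.1 i.2 (hre i hi)))
    have h0 : 0 ≤ ‖J1 χ i.1 i.2 - Jtilde1 χ i.1 i.2‖ := norm_nonneg _
    have h2 : ‖J1 χ i.1 i.2 - Jtilde1 χ i.1 i.2‖ ^ 2 ≤ 2 * ‖frakI1Sum χ i.1 i.2‖ ^ 2 + 2 * E ^ 2 := by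
      nlinarith [sq_nonneg (‖frakI1Sum χ i.1 i.2‖ - E)]
    have h3 := mul_le_mul_of_nonneg_right (mul_le_mul_of_nonneg_left h2 (hc0 i hi)) (hω i hi).le
    calc _ ≤ (cstar c' D i.1 i.2).re * (2 * ‖frakI1Sum χ i.1 i.2‖ ^ 2 + 2 * E ^ 2) *
          (omegaW D i.2).re := h3
      _ = _ := by ring
  have hX : 0 ≤ frakA χ * frakP D := mul_nonneg (frakA_nonneg χ) (frakP_nonneg D)
  have hP : 0 ≤ frakP D := frakP_nonneg D
  have hWD := hW' hA
  have h19D := h19' hA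
  have haD : a₀ ≤ frakA χ := ha' hA
  have hW0 : 0 ≤ ∑ i ∈ idx χ, (cstar c' D i.1 i.2).re * (omegaW D i.2).re :=
    Finset.sum_nonneg fun i hi => mul_nonneg (hc0 i hi) (hω i hi).le
  -- the absorbed term: `2E²·W ≤ 2C₁²e^{−c𝓛¹⁰}K𝓛⁹𝔓 ≤ (ε/2)a₀𝔓 ≤ (ε/2)𝔞𝔓`
  have habs : 2 * E ^ 2 * ∑ i ∈ idx χ, (cstar c' D i.1 i.2).re * (omegaW D i.2).re ≤
      ε / 2 * frakA χ * frakP D := by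
    calc 2 * E ^ 2 * ∑ i ∈ idx χ, (cstar c' D i.1 i.2).re * (omegaW D i.2).re
        ≤ 2 * (C₁ ^ 2 * Real.exp (-c * ell D ^ 10)) * (K * ell D ^ 9 * frakP D) :=
          mul_le_mul (mul_le_mul_of_nonneg_left hE2 (by norm_num)) hWD hW0 (by positivity)
      _ = 2 * C₁ ^ 2 * K * (ell D ^ 9 * Real.exp (-c * ell D ^ 10)) * frakP D := by ring
      _ ≤ 2 * C₁ ^ 2 * K * δ * frakP D := by gcongr
      _ ≤ ε / 2 * a₀ * frakP D := by
          apply mul_le_mul_of_nonneg_right _ hP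
          rw [hδ]
          have hCK : 0 ≤ C₁ ^ 2 * K := by positivity
          rw [show 2 * C₁ ^ 2 * K * (ε * a₀ / (4 * (C₁ ^ 2 * K + 1))) =
              (C₁ ^ 2 * K / (C₁ ^ 2 * K + 1)) * (ε / 2 * a₀) by field_simp; ring]
          have : C₁ ^ 2 * K / (C₁ ^ 2 * K + 1) ≤ 1 := by
            rw [div_le_one (by positivity)]; linarith
          exact le_trans (mul_le_mul_of_nonneg_right this (by positivity)) (by rw [one_mul])
      _ ≤ ε / 2 * frakA χ * frakP D := by gcongr
  calc ∑ i ∈ idx χ, (cstar c' D i.1 i.2).re * ‖J1 χ i.1 i.2 - Jtilde1 χ i.1 i.2‖ ^ 2 *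
          (omegaW D i.2).re
      ≤ ∑ i ∈ idx χ, (2 * ((cstar c' D i.1 i.2).re * ‖frakI1Sum χ i.1 i.2‖ ^ 2 * (omegaW D i.2).re) +
          2 * E ^ 2 * ((cstar c' D i.1 i.2).re * (omegaW D i.2).re)) := Finset.sum_le_sum hterm
    _ = 2 * (∑ i ∈ idx χ, (cstar c' D i.1 i.2).re * ‖frakI1Sum χ i.1 i.2‖ ^ 2 * (omegaW D i.2).re) +
          2 * E ^ 2 * ∑ i ∈ idx χ, (cstar c' D i.1 i.2).re * (omegaW D i.2).re := by
        rw [Finset.sum_add_distrib, Finset.mul_sum, Finset.mul_sum]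
    _ ≤ 2 * (ε / 4 * frakA χ * frakP D) + ε / 2 * frakA χ * frakP D := by gcongr
    _ = ε * frakA χ * frakP D := by ring

/-- **`DedStep11u020` holds** (the node of `TypedSection11B`, v2 statement with Prop. 2.2 (i) among
its antecedents). [cite: Zhang2022LandauSiegel, §11 p. 64, tex L3302–L3305] -/
theorem dedStep11u020_holds (c' : ℝ) : DedStep11u020 c' :=
  fun h23 h22 h81 h71 ha h115 h19 => step11u020_of c' h23 h22 h81 h71 ha h115 h19

variable (c' : ℝ) in
/-- `DedStep11u020` — `_holds` alias of `dedStep11u020_holds` above under the fact's exact name, stated under the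
prover's own binders as section variables (appended 2026-08-28, D-0026 bookkeeping: the proof term is the
existing theorem of this file; no statement, definition or attribute is edited; no new named fact; the
ledger's debt table listed the fact unproved). [cite: Zhang2022LandauSiegel, §11 p. 64, tex L3302–L3305] -/
theorem _root_.Literature.NumberTheory.LFunctions.Zhang2022.Typed.TypedSection11B.DedStep11u020_holds :
    _root_.Literature.NumberTheory.LFunctions.Zhang2022.Typed.TypedSection11B.DedStep11u020 c' :=
  _root_.Literature.NumberTheory.LFunctions.Zhang2022.Section11Deductions.dedStep11u020_holds (c' := c')

/-! ### `Z22:Lem11.2.pf`: Lemma 11.2 from the smooth approximate functional equation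

What the three deduction nodes need beyond the cited display `Step11u024`: the series
`J̃₁(s,ψ) = Σ_nχψ(n)g̃₁(n)n^{−s}` and `J̃₂(1−s,ψ̄)` may be integrated in `z` term by term
(dominated convergence: `|χψ(n)n^{−s}g(P^z/n)| ≤ 2P^{0.504}n^{−3/2}` on `σ = 1/2`, using
`0 ≤ g(y) ≤ 2y`), the resulting functions of `z` are continuous, and
`∫_{0.5}^{0.502} G(1 − z)dz = ∫_{0.498}^{0.5} G(w)dw`. -/

section Smooth

open MeasureTheory Set

variable {D : ℕ}

/-- The Gaussian primitive `Φ(v) = ∫_{u ≤ v} e^{−Λu²}du` is continuous. [folklore] -/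
private theorem continuous_gaussPrimitive {Λ : ℝ} (hΛ : 0 < Λ) :
    Continuous fun v : ℝ => ∫ u in Set.Iic v, GaussWeight.gauss Λ u := by
  have hint := GaussWeight.integrable_gauss hΛ
  have h0 : (fun v : ℝ => ∫ u in Set.Iic v, GaussWeight.gauss Λ u) = fun v =>
      (∫ u in Set.Iic 0, GaussWeight.gauss Λ u) + ∫ u in (0 : ℝ)..v, GaussWeight.gauss Λ u := by
    funext v
    rw [← intervalIntegral.integral_Iic_sub_Iic hint.integrableOn hint.integrableOn]
    ring
  rw [h0]
  exact continuous_const.add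
    (intervalIntegral.continuous_primitive (fun a b => hint.intervalIntegrable) 0)

/-- `g` (= `Skeleton.gW D`, `Λ = 𝓛³⁰`) composed with a continuous nowhere-vanishing function is
continuous (`D ≥ 2`). [cite: Zhang2022LandauSiegel, §4 (4.1)] -/
theorem continuous_gW_comp (hD : 2 ≤ D) {φ : ℝ → ℝ} (hφ : Continuous φ) (hφ0 : ∀ z, φ z ≠ 0) :
    Continuous fun z => gW D (φ z) := by
  have hℓ : 0 < ell D := Real.log_pos (by exact_mod_cast (by omega : 1 < D))
  have hΛ : 0 < ell D ^ 30 := pow_pos hℓ 30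
  have h := (continuous_gaussPrimitive hΛ).comp (hφ.log hφ0)
  simp only [gW, GaussWeight.gWeight]
  exact continuous_const.mul h

/-- **`0 ≤ g(y) ≤ 2y`** for `y > 0` (`Λ = 𝓛³⁰ ≥ 1`): for `y ≥ 1` since `g < 1`; for `y ≤ 1` from
(4.3) `g(y) ≤ ½e^{−Λlog²y}` and `−Λv² ≤ −v² ≤ 1 − v`. [cite: Zhang2022LandauSiegel, §4 (4.3)] -/
theorem gW_le_two_mul (hD : 3 ≤ D) {y : ℝ} (hy : 0 < y) : 0 ≤ gW D y ∧ gW D y ≤ 2 * y := by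
  have hℓ : 1 < ell D := one_lt_ell hD
  have hΛ : 0 < ell D ^ 30 := by positivity
  have hΛ1 : 1 ≤ ell D ^ 30 := one_le_pow₀ hℓ.le
  refine ⟨(GaussWeight.gWeight_pos hΛ y).le, ?_⟩
  rw [gW]
  rcases le_or_gt 1 y with h1 | h1
  · linarith [GaussWeight.gWeight_lt_one hΛ y]
  · have hg := GaussWeight.gWeight_le hΛ hy h1.le
    set v : ℝ := Real.log y with hv
    have hyv : Real.exp v = y := by rw [hv, Real.exp_log hy]
    have hexp : Real.exp (-(ell D ^ 30) * v ^ 2) ≤ Real.exp 1 * y := by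
      rw [← hyv, ← Real.exp_add, Real.exp_le_exp]
      nlinarith [sq_nonneg (v + 1), mul_le_mul_of_nonneg_right hΛ1 (sq_nonneg v)]
    have he : Real.exp 1 < 3 := lt_trans Real.exp_one_lt_d9 (by norm_num)
    nlinarith [Real.exp_pos 1]

variable (χ : DirichletCharacter ℂ D) (x : Chr D)

/-- `|χψ(n)| ≤ 1`. [cite: Zhang2022LandauSiegel, §2 (2.23)] -/
theorem norm_pc_le_one (n : ℕ) : ‖pc χ x n‖ ≤ 1 := by
  rw [pc, norm_mul]
  exact mul_le_one₀ (DirichletCharacter.norm_le_one _ _) (norm_nonneg _)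
    (DirichletCharacter.norm_le_one _ _)

/-- Dominated convergence for a series of continuous functions with summable sup-norms on
`[a, b]`: the series may be integrated term by term over `[a, b]`, and its sum is continuous there.
[folklore] -/
private theorem hasSum_integral_of_le {f : ℕ → ℝ → ℂ} {a b : ℝ} (hab : a ≤ b) {B : ℕ → ℝ}
    (hB : Summable B) (hcont : ∀ n, Continuous (f n))
    (hle : ∀ n, ∀ z ∈ Set.Icc a b, ‖f n z‖ ≤ B n) :
    HasSum (fun n => ∫ z in a..b, f n z) (∫ z in a..b, ∑' n, f n z) ∧
      ContinuousOn (fun z => ∑' n, f n z) (Set.Icc a b) := by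
  have hIcc : Set.uIoc a b ⊆ Set.Icc a b := by
    rw [Set.uIoc_of_le hab]; exact Set.Ioc_subset_Icc_self
  refine ⟨?_, continuousOn_tsum (fun n => (hcont n).continuousOn) hB fun n z hz => hle n z hz⟩
  refine intervalIntegral.hasSum_integral_of_dominated_convergence (fun n _ => B n)
    (fun n => (hcont n).aestronglyMeasurable) (fun n => ae_of_all _ fun z hz => hle n z (hIcc hz))
    (ae_of_all _ fun z _ => hB) intervalIntegrable_const (ae_of_all _ fun z hz => ?_)
  exact (Summable.of_norm_bounded hB (fun n => hle n z (hIcc hz))).hasSum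

/-- Continuity of `z ↦ χψ(n)n^{−s}g(P^z/n)`. [cite: Zhang2022LandauSiegel, §11 Lemma 11.2 (proof), p. 65] -/
theorem continuous_fTerm (hD : 2 ≤ D) (s : ℂ) (n : ℕ) :
    Continuous fun z : ℝ => pc χ x n * (n : ℂ) ^ (-s) * (gW D (bigP D ^ z / (n : ℝ)) : ℂ) := by
  refine continuous_const.mul (Complex.continuous_ofReal.comp ?_)
  rcases Nat.eq_zero_or_pos n with rfl | hn
  · simp only [Nat.cast_zero, div_zero]; exact continuous_const
  · have hP : 0 < bigP D := Real.exp_pos _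
    refine continuous_gW_comp hD ((Real.continuous_const_rpow hP.ne').div_const _) fun z => ?_
    exact div_ne_zero (Real.rpow_pos_of_pos hP z).ne' (by exact_mod_cast hn.ne')

/-- Continuity of `z ↦ χψ̄(n)n^{−(1−s)}g(P^zDt₀/n)`. [cite: Zhang2022LandauSiegel, §11 Lemma 11.2 (proof), p. 65] -/
theorem continuous_gTerm (hD : 2 ≤ D) (s : ℂ) (n : ℕ) :
    Continuous fun z : ℝ =>
      conj (pc χ x n) * (n : ℂ) ^ (-(1 - s)) * (gW D (bigP D ^ z * (D : ℝ) * t0 D / (n : ℝ)) : ℂ) := by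
  refine continuous_const.mul (Complex.continuous_ofReal.comp ?_)
  rcases Nat.eq_zero_or_pos n with rfl | hn
  · simp only [Nat.cast_zero, div_zero]; exact continuous_const
  · have hP : 0 < bigP D := Real.exp_pos _
    have hℓ : 0 < ell D := Real.log_pos (by exact_mod_cast (by omega : 1 < D))
    have ht : 0 < t0 D := by rw [t0]; positivity
    have hD0 : (0 : ℝ) < D := by exact_mod_cast (by omega : 0 < D)
    refine continuous_gW_comp hD
      ((((Real.continuous_const_rpow hP.ne').mul continuous_const).mul continuous_const).div_const _)
      fun z => ?_
    exact div_ne_zero (mul_pos (mul_pos (Real.rpow_pos_of_pos hP z) hD0) ht).ne'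
      (by exact_mod_cast hn.ne')

/-- On `σ = 1/2` and `z ≤ b`: `|χψ(n)n^{−s}g(P^z/n)| ≤ 2P^b·n^{−3/2}`.
[cite: Zhang2022LandauSiegel, §11 Lemma 11.2 (proof), p. 65] -/
theorem norm_fTerm_le (hD : 3 ≤ D) {s : ℂ} (hs : s.re = 1 / 2) (n : ℕ) {z b : ℝ} (hz : z ≤ b) :
    ‖pc χ x n * (n : ℂ) ^ (-s) * (gW D (bigP D ^ z / (n : ℝ)) : ℂ)‖ ≤ 2 * bigP D ^ b / (n : ℝ) ^ (3 / 2 : ℝ) := by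
  rcases Nat.eq_zero_or_pos n with rfl | hn
  · have h0 : (0 : ℂ) ^ (-s) = 0 := Complex.zero_cpow (by
      intro h; have := congrArg Complex.re h; norm_num [hs] at this)
    simp only [Nat.cast_zero]
    rw [h0, mul_zero, zero_mul, norm_zero]
    have hP : 0 < bigP D := Real.exp_pos _
    positivity
  · have hP1 : 1 ≤ bigP D := Real.one_le_exp (by rw [ell]; positivity)
    have hn' : (0 : ℝ) < n := by exact_mod_cast hn
    have hy : 0 < bigP D ^ z / (n : ℝ) := div_pos (Real.rpow_pos_of_pos (by linarith) z) hn'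
    obtain ⟨hg0, hg⟩ := gW_le_two_mul hD hy
    have hcpow : ‖(n : ℂ) ^ (-s)‖ = (n : ℝ) ^ (-(1 / 2 : ℝ)) := by
      rw [Complex.norm_natCast_cpow_of_pos hn]; simp [hs]
    have hzb : bigP D ^ z ≤ bigP D ^ b := Real.rpow_le_rpow_of_exponent_le hP1 hz
    rw [norm_mul, norm_mul, hcpow, Complex.norm_real, Real.norm_of_nonneg hg0]
    have hr : 0 < (n : ℝ) ^ (-(1 / 2 : ℝ)) := Real.rpow_pos_of_pos hn' _
    calc ‖pc χ x n‖ * (n : ℝ) ^ (-(1 / 2 : ℝ)) * gW D (bigP D ^ z / n)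
        ≤ 1 * (n : ℝ) ^ (-(1 / 2 : ℝ)) * (2 * (bigP D ^ z / n)) :=
          mul_le_mul (mul_le_mul_of_nonneg_right (norm_pc_le_one χ x n) hr.le) hg hg0
            (by positivity)
      _ ≤ 1 * (n : ℝ) ^ (-(1 / 2 : ℝ)) * (2 * (bigP D ^ b / n)) := by gcongr
      _ = 2 * bigP D ^ b / (n : ℝ) ^ (3 / 2 : ℝ) := by
          rw [show (3 / 2 : ℝ) = 1 / 2 + 1 by norm_num, Real.rpow_add_one hn'.ne',
            Real.rpow_neg hn'.le]
          field_simp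

/-- On `σ = 1/2` and `z ≤ b`: `|χψ̄(n)n^{−(1−s)}g(P^zDt₀/n)| ≤ 2P^bDt₀·n^{−3/2}`.
[cite: Zhang2022LandauSiegel, §11 Lemma 11.2 (proof), p. 65] -/
theorem norm_gTerm_le (hD : 3 ≤ D) {s : ℂ} (hs : s.re = 1 / 2) (n : ℕ) {z b : ℝ} (hz : z ≤ b) :
    ‖conj (pc χ x n) * (n : ℂ) ^ (-(1 - s)) * (gW D (bigP D ^ z * (D : ℝ) * t0 D / (n : ℝ)) : ℂ)‖ ≤
      2 * (bigP D ^ b * D * t0 D) / (n : ℝ) ^ (3 / 2 : ℝ) := by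
  have hℓ : 1 < ell D := one_lt_ell hD
  have ht : 0 < t0 D := by rw [t0]; positivity
  have hD0 : (0 : ℝ) < D := by exact_mod_cast (by omega : 0 < D)
  rcases Nat.eq_zero_or_pos n with rfl | hn
  · have h0 : (0 : ℂ) ^ (-(1 - s)) = 0 := Complex.zero_cpow (by
      intro h; have := congrArg Complex.re h; norm_num [hs] at this)
    simp only [Nat.cast_zero]
    rw [h0, mul_zero, zero_mul, norm_zero]
    have hP : 0 < bigP D := Real.exp_pos _
    positivity
  · have hP1 : 1 ≤ bigP D := Real.one_le_exp (by rw [ell]; positivity)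
    have hn' : (0 : ℝ) < n := by exact_mod_cast hn
    have hy : 0 < bigP D ^ z * D * t0 D / (n : ℝ) :=
      div_pos (mul_pos (mul_pos (Real.rpow_pos_of_pos (by linarith) z) hD0) ht) hn'
    obtain ⟨hg0, hg⟩ := gW_le_two_mul hD hy
    have hcpow : ‖(n : ℂ) ^ (-(1 - s))‖ = (n : ℝ) ^ (-(1 / 2 : ℝ)) := by
      rw [Complex.norm_natCast_cpow_of_pos hn]
      congr 1
      simp [hs]; norm_num
    have hzb : bigP D ^ z ≤ bigP D ^ b := Real.rpow_le_rpow_of_exponent_le hP1 hz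
    rw [norm_mul, norm_mul, hcpow, Complex.norm_real, Real.norm_of_nonneg hg0,
      RCLike.norm_conj]
    have hr : 0 < (n : ℝ) ^ (-(1 / 2 : ℝ)) := Real.rpow_pos_of_pos hn' _
    calc ‖pc χ x n‖ * (n : ℝ) ^ (-(1 / 2 : ℝ)) * gW D (bigP D ^ z * D * t0 D / n)
        ≤ 1 * (n : ℝ) ^ (-(1 / 2 : ℝ)) * (2 * (bigP D ^ z * D * t0 D / n)) :=
          mul_le_mul (mul_le_mul_of_nonneg_right (norm_pc_le_one χ x n) hr.le) hg hg0
            (by positivity)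
      _ ≤ 1 * (n : ℝ) ^ (-(1 / 2 : ℝ)) * (2 * (bigP D ^ b * D * t0 D / n)) := by gcongr
      _ = 2 * (bigP D ^ b * D * t0 D) / (n : ℝ) ^ (3 / 2 : ℝ) := by
          rw [show (3 / 2 : ℝ) = 1 / 2 + 1 by norm_num, Real.rpow_add_one hn'.ne',
            Real.rpow_neg hn'.le]
          field_simp

/-- `Σ_n K·n^{−3/2}` converges. [folklore] -/
private theorem summable_div_rpow32 (K : ℝ) : Summable fun n : ℕ => K / (n : ℝ) ^ (3 / 2 : ℝ) := by
  have h := (Real.summable_one_div_nat_rpow.mpr (by norm_num : (1 : ℝ) < 3 / 2)).mul_left K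
  refine h.congr fun n => ?_
  ring

/-- **`Σ_nχψ(n)n^{−s}g(P^z/n)` integrated term by term over `[a,b] ⊆ (−∞, 0.504]`, and continuous
in `z`** (`σ = 1/2`). [cite: Zhang2022LandauSiegel, §11 Lemma 11.2 (proof), p. 65] -/
theorem hasSum_fTerm (hD : 3 ≤ D) {s : ℂ} (hs : s.re = 1 / 2) {a b : ℝ} (hab : a ≤ b) :
    HasSum (fun n : ℕ => ∫ z in a..b, pc χ x n * (n : ℂ) ^ (-s) * (gW D (bigP D ^ z / (n : ℝ)) : ℂ))
        (∫ z in a..b, ∑' n : ℕ, pc χ x n * (n : ℂ) ^ (-s) * (gW D (bigP D ^ z / (n : ℝ)) : ℂ)) ∧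
      ContinuousOn (fun z : ℝ => ∑' n : ℕ, pc χ x n * (n : ℂ) ^ (-s) * (gW D (bigP D ^ z / (n : ℝ)) : ℂ)) (Set.Icc a b) :=
  hasSum_integral_of_le hab (summable_div_rpow32 (2 * bigP D ^ b))
    (continuous_fTerm χ x (by omega) s) fun n z hz => norm_fTerm_le χ x hD hs n hz.2

/-- The reflected series integrated term by term and continuous in `z` (`σ = 1/2`).
[cite: Zhang2022LandauSiegel, §11 Lemma 11.2 (proof), p. 65] -/
theorem hasSum_gTerm (hD : 3 ≤ D) {s : ℂ} (hs : s.re = 1 / 2) {a b : ℝ} (hab : a ≤ b) :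
    HasSum (fun n : ℕ => ∫ z in a..b, conj (pc χ x n) * (n : ℂ) ^ (-(1 - s)) * (gW D (bigP D ^ z * (D : ℝ) * t0 D / (n : ℝ)) : ℂ))
        (∫ z in a..b, ∑' n : ℕ, conj (pc χ x n) * (n : ℂ) ^ (-(1 - s)) * (gW D (bigP D ^ z * (D : ℝ) * t0 D / (n : ℝ)) : ℂ)) ∧
      ContinuousOn (fun z : ℝ => ∑' n : ℕ, conj (pc χ x n) * (n : ℂ) ^ (-(1 - s)) * (gW D (bigP D ^ z * (D : ℝ) * t0 D / (n : ℝ)) : ℂ)) (Set.Icc a b) :=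
  hasSum_integral_of_le hab (summable_div_rpow32 (2 * (bigP D ^ b * D * t0 D)))
    (continuous_gTerm χ x (by omega) s) fun n z hz => norm_gTerm_le χ x hD hs n hz.2

/-- **`J̃₁(s,ψ) = −500∫_{0.5}^{0.502}{Σ_nχψ(n)n^{−s}g(P^z/n)}dz + 500∫_{0.502}^{0.504}{…}dz`**
(`σ = 1/2`; the definition of `g̃₁`, p. 62, and termwise integration).
[cite: Zhang2022LandauSiegel, §11 p. 62, p. 65] -/
theorem Jtilde1_eq_integrals (hD : 3 ≤ D) {s : ℂ} (hs : s.re = 1 / 2) :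
    Jtilde1 χ x s = -500 * (∫ z in (0.5 : ℝ)..0.502, ∑' n : ℕ, pc χ x n * (n : ℂ) ^ (-s) * (gW D (bigP D ^ z / (n : ℝ)) : ℂ)) +
      500 * ∫ z in (0.502 : ℝ)..0.504, ∑' n : ℕ, pc χ x n * (n : ℂ) ^ (-s) * (gW D (bigP D ^ z / (n : ℝ)) : ℂ) := by
  obtain ⟨hA, -⟩ := hasSum_fTerm χ x hD hs (a := 0.5) (b := 0.502) (by norm_num)
  obtain ⟨hB, -⟩ := hasSum_fTerm χ x hD hs (a := 0.502) (b := 0.504) (by norm_num)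
  have hterm : ∀ n : ℕ, pc χ x n * (gtilde1 D n : ℂ) * (n : ℂ) ^ (-s) =
      -500 * (∫ z in (0.5 : ℝ)..0.502, pc χ x n * (n : ℂ) ^ (-s) * (gW D (bigP D ^ z / (n : ℝ)) : ℂ)) +
        500 * ∫ z in (0.502 : ℝ)..0.504, pc χ x n * (n : ℂ) ^ (-s) * (gW D (bigP D ^ z / (n : ℝ)) : ℂ) := by
    intro n
    have e : (gtilde1 D n : ℂ) = -500 * (∫ z in (0.5 : ℝ)..0.502, (gW D (bigP D ^ z / (n : ℝ)) : ℂ)) +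
        500 * ∫ z in (0.502 : ℝ)..0.504, (gW D (bigP D ^ z / (n : ℝ)) : ℂ) := by
      rw [intervalIntegral.integral_ofReal, intervalIntegral.integral_ofReal, gtilde1]
      push_cast
      ring
    rw [intervalIntegral.integral_const_mul, intervalIntegral.integral_const_mul, e]
    ring
  rw [Jtilde1, tsum_congr hterm, (hA.summable.mul_left _).tsum_add (hB.summable.mul_left _),
    tsum_mul_left, tsum_mul_left, hA.tsum_eq, hB.tsum_eq]

/-- **`J̃₂(1−s,ψ̄) = −500∫_{0.496}^{0.498}{Σ_nχψ̄(n)n^{−(1−s)}g(P^zDt₀/n)}dz + 500∫_{0.498}^{0.5}{…}dz`**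
(`σ = 1/2`; the definition of `g̃₂`, p. 62, and termwise integration).
[cite: Zhang2022LandauSiegel, §11 p. 62, p. 65] -/
theorem Jtilde2Bar_eq_integrals (hD : 3 ≤ D) {s : ℂ} (hs : s.re = 1 / 2) :
    Jtilde2Bar χ x (1 - s) = -500 * (∫ z in (0.496 : ℝ)..0.498, ∑' n : ℕ, conj (pc χ x n) * (n : ℂ) ^ (-(1 - s)) * (gW D (bigP D ^ z * (D : ℝ) * t0 D / (n : ℝ)) : ℂ)) +
      500 * ∫ z in (0.498 : ℝ)..0.5, ∑' n : ℕ, conj (pc χ x n) * (n : ℂ) ^ (-(1 - s)) * (gW D (bigP D ^ z * (D : ℝ) * t0 D / (n : ℝ)) : ℂ) := by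
  obtain ⟨hA, -⟩ := hasSum_gTerm χ x hD hs (a := 0.496) (b := 0.498) (by norm_num)
  obtain ⟨hB, -⟩ := hasSum_gTerm χ x hD hs (a := 0.498) (b := 0.5) (by norm_num)
  have hterm : ∀ n : ℕ, conj (pc χ x n) * (gtilde2 D n : ℂ) * (n : ℂ) ^ (-(1 - s)) =
      -500 * (∫ z in (0.496 : ℝ)..0.498, conj (pc χ x n) * (n : ℂ) ^ (-(1 - s)) * (gW D (bigP D ^ z * (D : ℝ) * t0 D / (n : ℝ)) : ℂ)) +
        500 * ∫ z in (0.498 : ℝ)..0.5, conj (pc χ x n) * (n : ℂ) ^ (-(1 - s)) * (gW D (bigP D ^ z * (D : ℝ) * t0 D / (n : ℝ)) : ℂ) := by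
    intro n
    have e : (gtilde2 D n : ℂ) =
        -500 * (∫ z in (0.496 : ℝ)..0.498, (gW D (bigP D ^ z * (D : ℝ) * t0 D / (n : ℝ)) : ℂ)) +
          500 * ∫ z in (0.498 : ℝ)..0.5, (gW D (bigP D ^ z * (D : ℝ) * t0 D / (n : ℝ)) : ℂ) := by
      rw [intervalIntegral.integral_ofReal, intervalIntegral.integral_ofReal, gtilde2]
      push_cast
      ring
    rw [intervalIntegral.integral_const_mul, intervalIntegral.integral_const_mul, e]
    ring
  rw [Jtilde2Bar, tsum_congr hterm, (hA.summable.mul_left _).tsum_add (hB.summable.mul_left _),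
    tsum_mul_left, tsum_mul_left, hA.tsum_eq, hB.tsum_eq]

variable [NeZero D]

/-- The integration step of the proof of Lemma 11.2: from the pointwise approximate functional
equation on `[0.5, 0.504]` to its integral over `[a, b] ⊆ [0.5, 0.504]`, with
`∫_a^b G(1−z)dz = ∫_{1−b}^{1−a} G`. [cite: Zhang2022LandauSiegel, §11 Lemma 11.2 (proof), p. 65] -/
theorem integral_afe_le (hD : 3 ≤ D) {s : ℂ} (hs : s.re = 1 / 2) {C : ℝ} {a b : ℝ}
    (ha : 0.5 ≤ a) (hab : a ≤ b) (hb : b ≤ 0.504)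
    (h24 : ∀ z : ℝ, 0.5 ≤ z → z ≤ 0.504 →
      ‖(∑' n : ℕ, pc χ x n * (n : ℂ) ^ (-s) * (gW D (bigP D ^ z / (n : ℝ)) : ℂ)) -
          ((psiChi χ x).LFunction s -
            Zpc χ x s * ∑' n : ℕ, conj (pc χ x n) * (n : ℂ) ^ (-(1 - s)) * (gW D (bigP D ^ (1 - z) * (D : ℝ) * t0 D / (n : ℝ)) : ℂ))‖ ≤
        C * E2main χ x s) :
    ‖(∫ z in a..b, ∑' n : ℕ, pc χ x n * (n : ℂ) ^ (-s) * (gW D (bigP D ^ z / (n : ℝ)) : ℂ)) -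
        (((b - a : ℝ) : ℂ) * (psiChi χ x).LFunction s -
          Zpc χ x s * ∫ z in (1 - b)..(1 - a), ∑' n : ℕ, conj (pc χ x n) * (n : ℂ) ^ (-(1 - s)) * (gW D (bigP D ^ z * (D : ℝ) * t0 D / (n : ℝ)) : ℂ))‖ ≤
      C * E2main χ x s * (b - a) := by
  obtain ⟨-, hF⟩ := hasSum_fTerm χ x hD hs (a := a) (b := b) hab
  obtain ⟨-, hG⟩ := hasSum_gTerm χ x hD hs (a := 1 - b) (b := 1 - a) (by linarith)
  set F : ℝ → ℂ := fun z => ∑' n : ℕ, pc χ x n * (n : ℂ) ^ (-s) * (gW D (bigP D ^ z / (n : ℝ)) : ℂ) with hFdef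
  set G : ℝ → ℂ := fun z => ∑' n : ℕ, conj (pc χ x n) * (n : ℂ) ^ (-(1 - s)) * (gW D (bigP D ^ z * (D : ℝ) * t0 D / (n : ℝ)) : ℂ) with hGdef
  have hFi : IntervalIntegrable F volume a b :=
    (hF.mono (by rw [Set.uIcc_of_le hab])).intervalIntegrable
  have hG' : ContinuousOn (fun z => G (1 - z)) (Set.uIcc a b) := by
    rw [Set.uIcc_of_le hab]
    refine hG.comp (continuous_const.sub continuous_id).continuousOn fun z hz => ?_
    exact ⟨by linarith [hz.2], by linarith [hz.1]⟩
  have hRi : IntervalIntegrable (fun z => (psiChi χ x).LFunction s - Zpc χ x s * G (1 - z))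
      volume a b :=
    intervalIntegrable_const.sub ((hG'.intervalIntegrable).const_mul _)
  have hsub : (∫ z in a..b, F z) - (((b - a : ℝ) : ℂ) * (psiChi χ x).LFunction s -
      Zpc χ x s * ∫ z in (1 - b)..(1 - a), G z) =
      ∫ z in a..b, (F z - ((psiChi χ x).LFunction s - Zpc χ x s * G (1 - z))) := by
    rw [intervalIntegral.integral_sub hFi hRi, intervalIntegral.integral_sub
      intervalIntegrable_const ((hG'.intervalIntegrable).const_mul _),
      intervalIntegral.integral_const, intervalIntegral.integral_const_mul,
      intervalIntegral.integral_comp_sub_left (fun z => G z) 1, Complex.real_smul]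
  rw [hsub]
  have hbound : ∀ z ∈ Set.uIoc a b,
      ‖F z - ((psiChi χ x).LFunction s - Zpc χ x s * G (1 - z))‖ ≤ C * E2main χ x s := by
    intro z hz
    rw [Set.uIoc_of_le hab] at hz
    exact h24 z (by linarith [hz.1]) (by linarith [hz.2])
  have := intervalIntegral.norm_integral_le_of_norm_le_const hbound
  rwa [abs_of_nonneg (by linarith : 0 ≤ b - a)] at this

variable (c' : ℝ)

/-- **`DedStep11u025` holds**: the first integrated identity from the smooth approximate functional
equation (`∫_{0.5}^{0.502}dz = 1/500`, `z ↦ 1 − z`). [cite: Zhang2022LandauSiegel, §11 Lemma 11.2 (proof), p. 65, tex L3329–L3337] -/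
theorem dedStep11u025_holds : DedStep11u025 := by
  rintro ⟨C, D₀, h⟩
  refine ⟨C * (1 / 500), max D₀ 3, fun D _ χ hD hq hp hA x s hs ht => ?_⟩
  have hD3 : 3 ≤ D := le_trans (le_max_right _ _) hD
  have h24 := h D χ (le_trans (le_max_left _ _) hD) hq hp hA x s hs ht
  have key := integral_afe_le χ x hD3 hs (a := 0.5) (b := 0.502) (by norm_num) (by norm_num)
    (by norm_num) h24
  have e1 : ((0.502 - 0.5 : ℝ) : ℂ) = (1 / 500 : ℂ) := by norm_num
  have e2 : (1 : ℝ) - 0.502 = 0.498 := by norm_num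
  have e3 : (1 : ℝ) - 0.5 = 0.5 := by norm_num
  rw [e1, e2, e3] at key
  calc _ ≤ C * E2main χ x s * (0.502 - 0.5) := key
    _ = C * (1 / 500) * E2main χ x s := by ring

/-- **`DedStep11u026` holds**: the second integrated identity (window `[0.502, 0.504]`, reflected
window `[0.496, 0.498]`). [cite: Zhang2022LandauSiegel, §11 Lemma 11.2 (proof), p. 65, tex L3338–L3346] -/
theorem dedStep11u026_holds : DedStep11u026 := by
  rintro ⟨C, D₀, h⟩
  refine ⟨C * (1 / 500), max D₀ 3, fun D _ χ hD hq hp hA x s hs ht => ?_⟩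
  have hD3 : 3 ≤ D := le_trans (le_max_right _ _) hD
  have h24 := h D χ (le_trans (le_max_left _ _) hD) hq hp hA x s hs ht
  have key := integral_afe_le χ x hD3 hs (a := 0.502) (b := 0.504) (by norm_num) (by norm_num)
    (by norm_num) h24
  have e1 : ((0.504 - 0.502 : ℝ) : ℂ) = (1 / 500 : ℂ) := by norm_num
  have e2 : (1 : ℝ) - 0.504 = 0.496 := by norm_num
  have e3 : (1 : ℝ) - 0.502 = 0.498 := by norm_num
  rw [e1, e2, e3] at key
  calc _ ≤ C * E2main χ x s * (0.504 - 0.502) := key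
    _ = C * (1 / 500) * E2main χ x s := by ring

/-- **`DedLem112` holds**: Lemma 11.2 (`Skeleton.Lemma112`) from the smooth approximate functional
equation `Step11u024` — the two integrated identities, `J̃₁ = −500∫_{0.5}^{0.502} + 500∫_{0.502}^{0.504}`,
`J̃₂(1−s,ψ̄) = −500∫_{0.496}^{0.498} + 500∫_{0.498}^{0.5}`, and the cancellation of the two
`(1/500)L(s,χψ)`. [cite: Zhang2022LandauSiegel, §11 Lemma 11.2 (proof), p. 65, tex L3329–L3346] -/
theorem dedLem112_holds : DedLem112 := by
  intro h24
  obtain ⟨C₅, h25⟩ := dedStep11u025_holds h24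
  obtain ⟨C₆, h26⟩ := dedStep11u026_holds h24
  obtain ⟨D₀, h⟩ := h25.and h26
  refine ⟨500 * C₅ + 500 * C₆, max D₀ 3, fun D _ χ hD hq hp hA x s hs ht => ?_⟩
  have hD3 : 3 ≤ D := le_trans (le_max_right _ _) hD
  obtain ⟨h25', h26'⟩ := h D χ (le_trans (le_max_left _ _) hD) hq hp
  have k5 := h25' hA x s hs ht
  have k6 := h26' hA x s hs ht
  rw [Jtilde1_eq_integrals χ x hD3 hs, Jtilde2Bar_eq_integrals χ x hD3 hs]
  set A₁ := ∫ z in (0.5 : ℝ)..0.502, ∑' n : ℕ, pc χ x n * (n : ℂ) ^ (-s) *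
    (gW D (bigP D ^ z / (n : ℝ)) : ℂ)
  set A₂ := ∫ z in (0.502 : ℝ)..0.504, ∑' n : ℕ, pc χ x n * (n : ℂ) ^ (-s) *
    (gW D (bigP D ^ z / (n : ℝ)) : ℂ)
  set B₁ := ∫ z in (0.496 : ℝ)..0.498, ∑' n : ℕ, conj (pc χ x n) * (n : ℂ) ^ (-(1 - s)) *
    (gW D (bigP D ^ z * (D : ℝ) * t0 D / (n : ℝ)) : ℂ)
  set B₂ := ∫ z in (0.498 : ℝ)..0.5, ∑' n : ℕ, conj (pc χ x n) * (n : ℂ) ^ (-(1 - s)) *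
    (gW D (bigP D ^ z * (D : ℝ) * t0 D / (n : ℝ)) : ℂ)
  set L := (psiChi χ x).LFunction s
  set Z := Zpc χ x s
  have key : -500 * A₁ + 500 * A₂ - Z * (-500 * B₁ + 500 * B₂) =
      -500 * (A₁ - ((1 / 500 : ℂ) * L - Z * B₂)) + 500 * (A₂ - ((1 / 500 : ℂ) * L - Z * B₁)) := by
    ring
  rw [key]
  calc ‖-500 * (A₁ - ((1 / 500 : ℂ) * L - Z * B₂)) + 500 * (A₂ - ((1 / 500 : ℂ) * L - Z * B₁))‖
      ≤ ‖-500 * (A₁ - ((1 / 500 : ℂ) * L - Z * B₂))‖ + ‖500 * (A₂ - ((1 / 500 : ℂ) * L - Z * B₁))‖ :=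
        norm_add_le _ _
    _ = 500 * ‖A₁ - ((1 / 500 : ℂ) * L - Z * B₂)‖ + 500 * ‖A₂ - ((1 / 500 : ℂ) * L - Z * B₁)‖ := by
        rw [norm_mul, norm_mul, norm_neg]; norm_num
    _ ≤ 500 * (C₅ * E2main χ x s) + 500 * (C₆ * E2main χ x s) := by gcongr
    _ = (500 * C₅ + 500 * C₆) * E2main χ x s := by ring

end Smooth

/-! ### The §11 chain composed: (11.1) and Proposition 2.6 from the printed leaves -/

section Composed

variable (c' : ℝ)

/-- **(11.1) (`Skeleton.Eval111`) from the five printed leaves of §11b** — (11.5) (`Eq115`), the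
windowed mean square (`Step11u019`, "by (11.3), (8.25), (8.26)"), the `J₂` mean square
(`Step11u021`, "Similarly"), the smooth approximate functional equation (`Step11u024`, "similar to
the proof of Lemma 6.1") and the `E₂` mean square (`Step11u027`, "by (8.25), (8.26) and simple
estimates") — together with the silent inputs Lemma 2.3, Prop. 2.2 (i), `χψ` primitive, Lemma 8.1,
Prop. 7.1 (total mass) and `𝔞 ≫ 1`; composing `dedStep11u020_holds`, `dedLem112_holds` (this file)
with `dedEq116_holds`, `dedProp26_holds` (`TypedSection11B`). This refines the banked leaf
`Skeleton.Ded111` of the whole-DAG theorem. [cite: Zhang2022LandauSiegel, §11 pp. 62–66] -/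
theorem eval111_of_leaves (h23 : Lemma23 c') (h22 : Prop22i) (hprim : PsiChiPrimitive)
    (h81 : Lemma81 c') (h71 : Prop71 c') (ha : FrakALowerBound) (h115 : Eq115)
    (h19 : Step11u019 c') (h21 : Step11u021 c') (h24 : Step11u024) (h27 : Step11u027 c') :
    Eval111 c' :=
  dedProp26_holds c' h23 h22 hprim (dedStep11u020_holds c' h23 h22 h81 h71 ha h115 h19) h21
    (dedEq116_holds c' h23 h22 (dedLem112_holds h24) h27)

/-- **Proposition 2.6 from the printed leaves of §§9, 11**: the above and (9.7) (`Skeleton.Eval97`),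
via the banked Cauchy step `Skeleton.prop26_of_evals`. [cite: Zhang2022LandauSiegel, §11 p. 62] -/
theorem prop26_of_leaves (h23 : Lemma23 c') (h22 : Prop22i) (hprim : PsiChiPrimitive)
    (h81 : Lemma81 c') (h71 : Prop71 c') (ha : FrakALowerBound) (h97 : Eval97 c') (h115 : Eq115)
    (h19 : Step11u019 c') (h21 : Step11u021 c') (h24 : Step11u024) (h27 : Step11u027 c') :
    Prop26 c' :=
  prop26_of_evals h22 h23 hprim
    (eval111_of_leaves c' h23 h22 hprim h81 h71 ha h115 h19 h21 h24 h27) h97 ha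

end Composed

end Literature.NumberTheory.LFunctions.Zhang2022.Section11Deductions
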